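import Mathlib
import Literature.Probability.LatticeModels.GKSInequalities
import Summits.CriticalPhenomena.Ising3DConformalLimit.Theses.PrecisionLaplacian

/-!
# Sketch — first lemmas for two crux-idea cards on `InverseMFerromagnet`
(stmt-CriticalPhenomena-4798; crux-ideate round 1, ideator 3, gen 2)

Card `stieltjes-loop-correction` (Bethe/Ihara recentring):
* `corr`, `corrMatrix`, `pairCoupling`, `bethePrecision` — the tree-exact (Bethe, Ihara–Bass)
  precision `Γ_B = I + Σ_e sinh²K_e (E_aa+E_bb) − ½ sinh 2K_e (E_ab+E_ba)`.
* `NonAdjacentInverseM` (NIM) — IM asserted only for NON-adjacent pairs.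
* `BetheComparison` (B♯) — `Σ⁻¹ ≤ Γ_B` off the diagonal; `DressedBetheComparison` (DB♯) — the
  sharper edge bound `(Σ⁻¹)_xy ≤ −t/(1+t²−2t⟨σ_xσ_y⟩)` coming from the subdivision identity.
* `nim_iff_im`, `betheComparison_iff_im` — the equivalences (subdivision identity; statements).
* `StieltjesLoopCorrection` (SLC) — the transfer C⁺: `S := Σ⁻¹ − Γ_B` is positive semidefinite
  with nonpositive off-diagonal entries (a Stieltjes matrix); `slc_implies_im`.
* `CycleLoopCorrection` — the closed form on cycles `S(C_N) = 2t^N/(1−t^N)·Γ_B(C_N)` (provable now).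
Card `ising-domination-principle` (potential theory of the magnetisation response):
* `mag` — `⟨σ_x⟩` of the pair system in a nonnegative field (fields = couplings on singletons).
* `DominationPrinciple` (DP, linear; Choquet–Deny form of IM), `dominationPrinciple_iff_im`.
* `MonotoneExtension` (ME) and `NonlinearDomination` (NDP) — inverse-free comparison principles
  for one-point functions of two nonnegative-field states; `ndp_implies_dp` (linearisation).
-/

namespace Summit.CriticalPhenomena.Ising3DConformalLimit.Cruxes.InverseMFerromagnet.SketchK3g2

open scoped BigOperators
open Literature.Probability.LatticeModels
open Summit.CriticalPhenomena.Ising3DConformalLimit.Theses.PrecisionLaplacian (InverseMFerromagnet)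

noncomputable section

/-- Pair correlation `⟨σ_x σ_y⟩` of the zero-field pair system `(K, C)` on `Fin n`. -/
def corr (n m : ℕ) (K : Fin m → ℝ) (C : Fin m → Finset (Fin n)) (x y : Fin n) : ℝ :=
  gksExpect Finset.univ K C (fun ω => spinAt x ω * spinAt y ω)

/-- The second-moment matrix `Σ` of the crux. -/
def corrMatrix (n m : ℕ) (K : Fin m → ℝ) (C : Fin m → Finset (Fin n)) :
    Matrix (Fin n) (Fin n) ℝ :=
  Matrix.of fun p q => corr n m K C p q

/-- Total coupling carried by the pair `{x, y}` (parallel couplings add). -/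
def pairCoupling (n m : ℕ) (K : Fin m → ℝ) (C : Fin m → Finset (Fin n)) (x y : Fin n) : ℝ :=
  ∑ i ∈ Finset.univ.filter (fun i => C i = {x, y}), K i

/-- The Bethe (tree-exact, Ihara–Bass) precision matrix `Γ_B`: with `t = tanh κ_xy`,
`(Γ_B)_xy = −t/(1−t²) = −½ sinh 2κ_xy` for `x ≠ y` and `(Γ_B)_xx = 1 + Σ_{y ≠ x} t²/(1−t²)
= 1 + Σ_{y≠x} sinh² κ_xy`. Equals `Σ⁻¹` exactly on forests. -/
def bethePrecision (n m : ℕ) (K : Fin m → ℝ) (C : Fin m → Finset (Fin n)) :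
    Matrix (Fin n) (Fin n) ℝ :=
  Matrix.of fun x y =>
    if x = y then 1 + ∑ z ∈ Finset.univ.erase x, Real.sinh (pairCoupling n m K C x z) ^ 2
    else -(Real.sinh (2 * pairCoupling n m K C x y)) / 2

/-- NIM: the crux asserted only for non-adjacent pairs. -/
def NonAdjacentInverseM : Prop :=
  ∀ (n m : ℕ) (K : Fin m → ℝ) (C : Fin m → Finset (Fin n)), (∀ i, 0 ≤ K i) →
    (∀ i, (C i).card = 2) → ∀ x y : Fin n, x ≠ y → (∀ i, C i ≠ {x, y}) →
      (corrMatrix n m K C)⁻¹ x y ≤ 0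

/-- B♯ (Bethe comparison): the precision lies below the Bethe precision off the diagonal. -/
def BetheComparison : Prop :=
  ∀ (n m : ℕ) (K : Fin m → ℝ) (C : Fin m → Finset (Fin n)), (∀ i, 0 ≤ K i) →
    (∀ i, (C i).card = 2) → ∀ x y : Fin n, x ≠ y →
      (corrMatrix n m K C)⁻¹ x y ≤ bethePrecision n m K C x y

/-- DB♯ (dressed Bethe comparison): with `t = tanh κ_xy` and `G = ⟨σ_xσ_y⟩`,
`(Σ⁻¹)_xy ≤ −t/(1 + t² − 2 t G)` (the right side is `0` when `κ_xy = 0` and `≤ −t/(1−t²)` since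
`G ≥ t`). It is IM for the graph with the pair `{x,y}` subdivided (exact subdivision identity). -/
def DressedBetheComparison : Prop :=
  ∀ (n m : ℕ) (K : Fin m → ℝ) (C : Fin m → Finset (Fin n)), (∀ i, 0 ≤ K i) →
    (∀ i, (C i).card = 2) → ∀ x y : Fin n, x ≠ y →
      (corrMatrix n m K C)⁻¹ x y ≤
        -(Real.tanh (pairCoupling n m K C x y)) /
          (1 + Real.tanh (pairCoupling n m K C x y) ^ 2
            - 2 * Real.tanh (pairCoupling n m K C x y) * corr n m K C x y)

/-- Subdivision reduction: IM for non-adjacent pairs already gives IM (subdivide the pair's edge;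
the new degree-2 row is explicit and the Schur complement only lowers the entry). -/
theorem nim_iff_im : NonAdjacentInverseM ↔ InverseMFerromagnet := by
  sorry

/-- B♯ ⇔ IM and DB♯ ⇔ IM over the class of all finite pair ferromagnets. -/
theorem betheComparison_iff_im :
    (BetheComparison ↔ InverseMFerromagnet) ∧ (DressedBetheComparison ↔ InverseMFerromagnet) := by
  sorry

/-- SLC (transfer C⁺): the loop correction `S = Σ⁻¹ − Γ_B` is a Stieltjes matrix — positive
semidefinite with nonpositive off-diagonal entries. `S = 0` on forests; on the cycle `C_N`,
`S = 2t^N/(1−t^N) · Γ_B(C_N)`. The Z-part is IM (via `betheComparison_iff_im`); the PSD part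
is new (kit j013446: 1192/1192 instances, n ≤ 12, all coupling regimes). -/
def StieltjesLoopCorrection : Prop :=
  ∀ (n m : ℕ) (K : Fin m → ℝ) (C : Fin m → Finset (Fin n)), (∀ i, 0 ≤ K i) →
    (∀ i, (C i).card = 2) →
      ((corrMatrix n m K C)⁻¹ - bethePrecision n m K C).PosSemidef ∧
      ∀ x y : Fin n, x ≠ y → ((corrMatrix n m K C)⁻¹ - bethePrecision n m K C) x y ≤ 0

theorem slc_implies_im : StieltjesLoopCorrection → InverseMFerromagnet := by
  sorry

/-- The cycle case of SLC in closed form (provable now by the degree-2 row formula):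
on `C_N` (sites `Fin N`, bonds `i ~ i+1`, uniform coupling `κ`, `t = tanh κ`),
`Σ⁻¹ = (1 + t^N)/(1 − t^N) · Γ_B`. -/
def CycleLoopCorrection : Prop :=
  ∀ (N : ℕ) (hN : 3 ≤ N) (κ : ℝ), 0 < κ →
    let C : Fin N → Finset (Fin N) := fun i => {i, ⟨(i.1 + 1) % N, Nat.mod_lt _ (by omega)⟩}
    let K : Fin N → ℝ := fun _ => κ
    (corrMatrix N N K C)⁻¹ =
      ((1 + Real.tanh κ ^ N) / (1 - Real.tanh κ ^ N)) • bethePrecision N N K C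

/-! ### Card `ising-domination-principle` -/

/-- Magnetisation `⟨σ_x⟩` of the pair system `(K, C)` in the field `g` (a field is a coupling on
the singleton `{a}`; index type `Fin m ⊕ Fin n`). -/
def mag (n m : ℕ) (K : Fin m → ℝ) (C : Fin m → Finset (Fin n)) (g : Fin n → ℝ) (x : Fin n) : ℝ :=
  gksExpect (Finset.univ : Finset (Fin m ⊕ Fin n)) (Sum.elim K g)
    (Sum.elim C (fun a => ({a} : Finset (Fin n)))) (spinAt x)

/-- DP (domination principle, Choquet–Deny form of inverse-M): for nonnegative charges `u, v`,
if the potential `Σv` dominates `Σu` on the support of `u`, it dominates everywhere.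
Here `(Σu)_x = ⟨σ_x · Σ_a u_a σ_a⟩` is the linear response of `⟨σ_x⟩` to the field `u`. -/
def DominationPrinciple : Prop :=
  ∀ (n m : ℕ) (K : Fin m → ℝ) (C : Fin m → Finset (Fin n)), (∀ i, 0 ≤ K i) →
    (∀ i, (C i).card = 2) → ∀ u v : Fin n → ℝ, (∀ a, 0 ≤ u a) → (∀ a, 0 ≤ v a) →
      (∀ a, u a ≠ 0 → (corrMatrix n m K C).mulVec u a ≤ (corrMatrix n m K C).mulVec v a) →
        ∀ x, (corrMatrix n m K C).mulVec u x ≤ (corrMatrix n m K C).mulVec v x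

/-- DP ⇔ IM (classical for nonnegative positive-definite kernels: DMS 2014 ch. 2; here `Σ` is
positive definite for every `K`, refuter's `corrMatrix_posDef`). -/
theorem dominationPrinciple_iff_im : DominationPrinciple ↔ InverseMFerromagnet := by
  sorry

/-- ME (monotone extension): among nonnegative fields supported on `S`, the magnetisation
profile on the whole graph is monotone in the magnetisation profile on `S`. Linearisation at
`g = g' = 0` is exactly IM (regression coefficients of `σ_x` on `σ_S` are nonnegative). -/
def MonotoneExtension : Prop :=
  ∀ (n m : ℕ) (K : Fin m → ℝ) (C : Fin m → Finset (Fin n)), (∀ i, 0 ≤ K i) →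
    (∀ i, (C i).card = 2) → ∀ (S : Finset (Fin n)) (g g' : Fin n → ℝ),
      (∀ a, 0 ≤ g a) → (∀ a, 0 ≤ g' a) → (∀ a ∉ S, g a = 0) → (∀ a ∉ S, g' a = 0) →
      (∀ a ∈ S, mag n m K C g a ≤ mag n m K C g' a) →
        ∀ x, mag n m K C g x ≤ mag n m K C g' x

/-- NDP (nonlinear domination principle): if a nonnegative field `h` magnetises every site of
the support of the nonnegative field `g` at least as much as `g` does, then it magnetises EVERY
site at least as much. `|supp g| ≤ 2`: two lines of GKS II. Survived adversarial search
(kit j013446 part C: 0/240). NDP ⇒ DP by linearisation; conversely IM + order-convexity of the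
GKS orthant image ⇒ NDP (card). -/
def NonlinearDomination : Prop :=
  ∀ (n m : ℕ) (K : Fin m → ℝ) (C : Fin m → Finset (Fin n)), (∀ i, 0 ≤ K i) →
    (∀ i, (C i).card = 2) → ∀ g h : Fin n → ℝ, (∀ a, 0 ≤ g a) → (∀ a, 0 ≤ h a) →
      (∀ a, g a ≠ 0 → mag n m K C g a ≤ mag n m K C h a) →
        ∀ x, mag n m K C g x ≤ mag n m K C h x

theorem ndp_implies_dp : NonlinearDomination → DominationPrinciple := by
  sorry

/-- The single-site case of NDP is a GKS one-liner:
`⟨σ_x⟩_h ≥ ⟨σ_xσ_a⟩_h ⟨σ_a⟩_h ≥ ⟨σ_xσ_a⟩_0 ⟨σ_a⟩_h ≥ ⟨σ_xσ_a⟩_0 ⟨σ_a⟩_g = ⟨σ_x⟩_g`. -/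
theorem ndp_single (n m : ℕ) (K : Fin m → ℝ) (C : Fin m → Finset (Fin n)) (hK : ∀ i, 0 ≤ K i)
    (hC : ∀ i, (C i).card = 2) (a : Fin n) (γ : ℝ) (hγ : 0 ≤ γ) (h : Fin n → ℝ)
    (hh : ∀ b, 0 ≤ h b)
    (hyp : mag n m K C (Function.update 0 a γ) a ≤ mag n m K C h a) :
    ∀ x, mag n m K C (Function.update 0 a γ) x ≤ mag n m K C h x := by
  sorry

end

end Summit.CriticalPhenomena.Ising3DConformalLimit.Cruxes.InverseMFerromagnet.SketchK3g2
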